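import Literature.Computability.AlgebraicComplexity.CircuitArithmetization
import Literature.Computability.AlgebraicComplexity.ConstantFreeDegree
import HarnessLib

/-!
# The transcript arithmetization is constant-free: `(size, formal degree)` bounds

Companion of `CircuitArithmetization.lean` (the transcript arithmetization `arith Q = VALID · OUT`
of a Boolean circuit `Q`, Valiant's criterion) and `ConstantFreeDegree.lean` (the predicate
`HasTauDeg f s d`: a fan-in-two constant-free circuit of size `≤ s` and formal degree `≤ d`).
`CircuitArithmetization.lean` bounds Bürgisser's `L` (`complexity`, arbitrary constants) and the
total degree of `arith Q`; for membership of arithmetized families in the CONSTANT-FREE class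
`VP⁰` (Bürgisser 2009, Def. 2.7; Koiran 2004, Thm. 6.1 = Bürgisser 2009, Thm. 2.11, the
"generalized Valiant criterion") one needs the constant-free size `τ` together with the FORMAL
degree, and under a substitution of the wire variables (the input wires of the circuit are fed
digit variables or the constants `0, 1`). We prove, for a substitution `g` of the variables by
polynomials of size `0` and formal degree `1` (variables or sign constants, `HasTauDeg (g v) 0 1`):

* `hasTauDeg_lit`, `hasTauDeg_tableExt`, `hasTauDeg_eqInd` — the Boolean gadgets (all constants
  are `0, ±1`);
* `hasTauDeg_aeval_consPoly : HasTauDeg (aeval g (consPoly Q j)) 59 3`,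
  `hasTauDeg_aeval_validPoly : HasTauDeg (aeval g (validPoly Q)) (60 |Q|) (3 |Q| + 1)`,
  `hasTauDeg_aeval_arith : HasTauDeg (aeval g (arith Q)) (60 |Q| + 1) (3 |Q| + 2)`
  (the same constants as `complexity_arith_le`, `totalDegree_arith_le`).

## References

* P. Bürgisser, *Completeness and Reduction in Algebraic Complexity Theory*, Springer 2000,
  Prop. 2.20 (Valiant's criterion) and its proof.
* P. Bürgisser, *On defining integers and proving arithmetic circuit lower bounds*, Comput.
  Complexity 18 (2009) = ECCC TR06-113, §2.2, Def. 2.7, Thm. 2.11.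
* P. Koiran, *Valiant's model and the cost of computing integers*, Comput. Complexity 13 (2004),
  Thm. 6.1.
-/

noncomputable section

open MvPolynomial

universe u v w

namespace Literature.Computability.AlgebraicComplexity

namespace CircuitArith

open Complexity ArithCircuit

variable {τ : Type w} {τ' : Type u}

/-! ### The gadgets -/

/-- `lit c p`: `(s + 2, max 1 d)`. [cite: Burgisser2000, proof of Prop. 2.20] -/
theorem hasTauDeg_lit {p : MvPolynomial τ ℤ} {s d : ℕ} (hp : HasTauDeg p s d) (c : Bool) :
    HasTauDeg (lit c p) (s + 2) (max 1 d) := by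
  cases c
  · exact hp.one_sub
  · exact hp.mono (by omega) (le_max_right _ _)

/-- `tableExt T u v` for leaves `u, v` of size `0` and formal degree `1`: `(26, 2)`. [cite: Burgisser2000, proof of Prop. 2.20] -/
theorem hasTauDeg_tableExt (T : Bool → Bool → Bool) {u v : MvPolynomial τ ℤ} (hu : HasTauDeg u 0 1)
    (hv : HasTauDeg v 0 1) : HasTauDeg (tableExt T u v) 26 2 := by
  unfold tableExt
  have hterm : ∀ b0 b1 : Bool, HasTauDeg (if T b0 b1 then lit b0 u * lit b1 v else 0 : MvPolynomial τ ℤ) 5 2 := by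
    intro b0 b1
    split_ifs
    · simpa using (hasTauDeg_lit hu b0).mul (hasTauDeg_lit hv b1)
    · exact HasTauDeg.zero.mono (by omega) (by omega)
  have hinner : ∀ b0 : Bool, HasTauDeg (∑ b1 : Bool, (if T b0 b1 then lit b0 u * lit b1 v else 0 : MvPolynomial τ ℤ)) 12 2 := by
    intro b0
    have h := HasTauDeg.finset_sum (Finset.univ : Finset Bool) (s := fun _ => 5) (d := 2)
      fun b1 _ => hterm b0 b1
    simpa using h
  have h := HasTauDeg.finset_sum (Finset.univ : Finset Bool) (s := fun _ => 12) (d := 2) fun b0 _ => hinner b0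
  simpa using h

/-- `eqInd y t`: `(sy + st + (sy + st) + 8, max (dy + dt) (max 1 dy + max 1 dt))`. [cite: Burgisser2000, proof of Prop. 2.20] -/
theorem hasTauDeg_eqInd {y t : MvPolynomial τ ℤ} {sy dy st dt : ℕ} (hy : HasTauDeg y sy dy) (ht : HasTauDeg t st dt) :
    HasTauDeg (eqInd y t) (2 * (sy + st) + 7) (max (dy + dt) (max 1 dy + max 1 dt)) := by
  unfold eqInd
  have h := (hy.mul ht).add (hy.one_sub.mul ht.one_sub)
  exact h.mono (by omega) le_rfl

/-! ### The arithmetization under a substitution of the wires -/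

variable {ι : Type v}

/-- `aeval` through `lit`. [folklore] -/
theorem aeval_lit (g : τ → MvPolynomial τ' ℤ) (c : Bool) (p : MvPolynomial τ ℤ) :
    aeval g (lit c p) = lit c (aeval g p) := by
  cases c <;> simp [lit, map_sub, map_one]

/-- `aeval` through `tableExt`. [folklore] -/
theorem aeval_tableExt (g : τ → MvPolynomial τ' ℤ) (T : Bool → Bool → Bool) (u v : MvPolynomial τ ℤ) :
    aeval g (tableExt T u v) = tableExt T (aeval g u) (aeval g v) := by
  unfold tableExt
  simp only [map_sum]
  refine Finset.sum_congr rfl fun b0 _ => Finset.sum_congr rfl fun b1 _ => ?_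
  split_ifs
  · rw [map_mul, aeval_lit, aeval_lit]
  · simp

/-- `aeval` through `eqInd`. [folklore] -/
theorem aeval_eqInd (g : τ → MvPolynomial τ' ℤ) (y t : MvPolynomial τ ℤ) :
    aeval g (eqInd y t) = eqInd (aeval g y) (aeval g t) := by
  simp [eqInd, map_add, map_mul, map_sub, map_one]

/-- A substituted wire is a leaf (a value of `g`) or `0`. [folklore] -/
theorem hasTauDeg_aeval_wirePoly {s : ℕ} {g : ι ⊕ Fin s → MvPolynomial τ' ℤ} (hg : ∀ v, HasTauDeg (g v) 0 1)
    (w : ι ⊕ ℕ) : HasTauDeg (aeval g (wirePoly (k := ℤ) s w)) 0 1 := by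
  cases w with
  | inl i => simpa [wirePoly] using hg (Sum.inl i)
  | inr m =>
    by_cases h : m < s
    · simpa [wirePoly, h] using hg (Sum.inr ⟨m, h⟩)
    · simpa [wirePoly, h] using (HasTauDeg.zero (σ := τ'))

/-- A substituted argument is a leaf or `0`. [folklore] -/
theorem hasTauDeg_aeval_argPoly {s : ℕ} {g : ι ⊕ Fin s → MvPolynomial τ' ℤ} (hg : ∀ v, HasTauDeg (g v) 0 1)
    (G : Gate ι) (a : ℕ) : HasTauDeg (aeval g (argPoly (k := ℤ) s G a)) 0 1 := by
  unfold argPoly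
  split_ifs
  · exact hasTauDeg_aeval_wirePoly hg _
  · simpa using (HasTauDeg.zero (σ := τ'))

/-- **The substituted consistency polynomial of a gate**: `(59, 3)`. [cite: Burgisser2000, proof of Prop. 2.20] -/
theorem hasTauDeg_aeval_consPoly (Q : Circuit ι) {g : ι ⊕ Fin Q.size → MvPolynomial τ' ℤ}
    (hg : ∀ v, HasTauDeg (g v) 0 1) (j : Fin Q.size) :
    HasTauDeg (aeval g (consPoly (k := ℤ) Q j)) 59 3 := by
  rw [consPoly, aeval_eqInd, aeval_tableExt, aeval_X]
  have h := hasTauDeg_eqInd (hg (Sum.inr j))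
    (hasTauDeg_tableExt (btable (Q.gates[j.val]'j.isLt))
      (hasTauDeg_aeval_argPoly hg (Q.gates[j.val]'j.isLt) 0)
      (hasTauDeg_aeval_argPoly hg (Q.gates[j.val]'j.isLt) 1))
  exact h.mono le_rfl (by simp)

/-- **The substituted transcript indicator** `VALID`: `(60 |Q|, 3 |Q| + 1)`. [cite: Burgisser2000, proof of Prop. 2.20] -/
theorem hasTauDeg_aeval_validPoly (Q : Circuit ι) {g : ι ⊕ Fin Q.size → MvPolynomial τ' ℤ}
    (hg : ∀ v, HasTauDeg (g v) 0 1) :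
    HasTauDeg (aeval g (validPoly (k := ℤ) Q)) (60 * Q.size) (3 * Q.size + 1) := by
  rw [validPoly, map_prod]
  have h := HasTauDeg.finset_prod (Finset.univ : Finset (Fin Q.size)) (s := fun _ => 59) (d := 3)
    fun j _ => hasTauDeg_aeval_consPoly Q hg j
  simp only [Finset.sum_const, Finset.card_univ, Fintype.card_fin, smul_eq_mul] at h
  exact h.mono (by omega) (by omega)

/-- **The substituted arithmetization** `arith Q = VALID · OUT`: `(60 |Q| + 1, 3 |Q| + 2)`. [cite: Burgisser2000, proof of Prop. 2.20] -/
theorem hasTauDeg_aeval_arith (Q : Circuit ι) {g : ι ⊕ Fin Q.size → MvPolynomial τ' ℤ}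
    (hg : ∀ v, HasTauDeg (g v) 0 1) :
    HasTauDeg (aeval g (arith (k := ℤ) Q)) (60 * Q.size + 1) (3 * Q.size + 2) := by
  rw [arith, map_mul]
  exact ((hasTauDeg_aeval_validPoly Q hg).mul (hasTauDeg_aeval_wirePoly hg Q.output)).mono (by omega) (by omega)

end CircuitArith

end Literature.Computability.AlgebraicComplexity
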